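import Mathlib.MeasureTheory.Integral.Bochner.Set
import Mathlib.MeasureTheory.Function.L2Space
import Mathlib.LinearAlgebra.Dual.Lemmas
import Mathlib.GroupTheory.DoubleCoset
import Literature.NumberTheory.Automorphic.MatrixCoefficients
import Literature.NumberTheory.Automorphic.CompactOpenAveraging
import HarnessLib

/-!
# Square-integrability modulo the centre forces square-summability of coefficient lower bounds on disjoint sets;
# the bi-`K`-invariant coefficient of a `K`-spherical smooth representation
# (Harish-Chandra 1970 Part I §1; Cartier 1979 §IV.1; Casselman 1995 §2.1)

Topic `NumberTheory/Automorphic`; namespace `Literature.NumberTheory.Automorphic.SphericalCoefficient`.  THEOREMS ONLY; no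
definition, no named fact, no instance, no notation, no `sorry`.  Cell `hodgecm-mathlib`, fan-B row #79 (XP
`Rogawski1990.XiPinSphericalCofinite`) pay-down, road (B) «local», brick (L4α): the two generic halves of «a `K`-spherical irreducible
representation whose `K` is hyperspecial of the larger degree is not square-integrable modulo the centre» that involve no structure
theory of the group — (i) the analytic book-keeping of ★ `Representation.IsSquareIntegrableModCenter` (domination of every smooth matrix
coefficient by an `L²(G⧸Z(G))` function) and (ii) the construction of the zonal spherical coefficient `ω(g) = φ₀(ρ(g) v₀)`.  The
structure-theoretic half (Cartan shells, Hecke recurrence) is ★ `RankOneHeckeRecurrenceNotSquareSummable` + its sequel.  HC_CM is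
proved only modulo the printed citations until rung 0 closes; this file is unconditional and generic.

## What is formalised
* §1 **`summable_sq_mul_measureReal`** — if `ρ` is square-integrable modulo the centre w.r.t. `μ` on `G ⧸ Z(G)` (★
  `IsSquareIntegrableModCenter`: `‖c_{φ,v}(g)‖ ≤ f(gZ)`, `f ∈ L²`), then for every `φ ∈ Ṽ`, `v ∈ V`, every sequence of pairwise
  disjoint measurable sets `S_n ⊆ G⧸Z(G)` of finite measure and constants `0 ≤ c_n ≤ ‖c_{φ,v}‖` on (the fibres over) `S_n`:
  `Σ_n c_n² · μ(S_n) < ∞` (`∑_{n<N} c_n² μ(S_n) ≤ ∫ f²` for all `N`).  [HarishChandra1970 Part I §1 p. 4: `∫_{G/Z} |(φ, π(x)ψ)|² dx*`.]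
* §2 **`exists_spherical_coefficient`** — for a SMOOTH `ρ` with a LINE of `K`-fixed vectors (★ `Representation.IsSpherical`), `K` compact
  open: there are `v₀ ∈ V^K`, `v₀ ≠ 0`, and `φ₀ ∈ Ṽ` with `φ₀(v₀) = 1` and `φ₀ ∘ ρ(κ) = φ₀` (`κ ∈ K`) — `φ₀ = ℓ ∘ e_K` for the averaging
  projector ★ `Representation.avgProjLinear` and any linear form `ℓ` with `ℓ(v₀) = 1`; hence (`matrixCoeff_mul_mul_of_mem`) the coefficient
  `ω = c_{φ₀,v₀}` is bi-`K`-invariant with `ω(1) = 1` — the zonal spherical function of `ρ` [CartierCorvallis1979 §IV.1 Cor. 4.1–4.2;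
  Casselman1995 §2.1 «`Ṽ^K = (V^K)^*`»].
-/

noncomputable section

open MeasureTheory Filter Topology

namespace Literature.NumberTheory.Automorphic.SphericalCoefficient

/-! ## §1 Square-integrability modulo the centre ⇒ square-summability on disjoint shells -/

section Summable

variable {G V : Type*} [Group G] [TopologicalSpace G] [SeparatelyContinuousMul G]
  [AddCommGroup V] [Module ℂ V] [MeasurableSpace (G ⧸ Subgroup.center G)]
  {ρ : Representation ℂ G V} {μ : Measure (G ⧸ Subgroup.center G)}

omit [TopologicalSpace G] [SeparatelyContinuousMul G] in
/-- **Finite shell sums are bounded by `∫ f²`.**  If `‖c_{φ,v}(g)‖ ≤ f(gZ)` with `f² ` integrable, `S_n` (`n < N`) are pairwise disjoint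
measurable sets of finite measure and `0 ≤ c_n ≤ ‖c_{φ,v}(g)‖` whenever `gZ ∈ S_n`, then `∑_{n<N} c_n² μ(S_n) ≤ ∫ f²`.
[cite: HarishChandra1970, Part I §1 p. 4] -/
theorem sum_sq_mul_measureReal_le_integral {φ : Module.Dual ℂ V} {v : V} {f : G ⧸ Subgroup.center G → ℝ}
    (hdom : ∀ g : G, ‖ρ.matrixCoeff φ v g‖ ≤ f (g : G ⧸ Subgroup.center G))
    (hint : Integrable (fun x => f x ^ 2) μ)
    {S : ℕ → Set (G ⧸ Subgroup.center G)} (hSm : ∀ n, MeasurableSet (S n)) (hSfin : ∀ n, μ (S n) < ⊤)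
    (hdisj : Pairwise (Function.onFun Disjoint S)) {c : ℕ → ℝ} (hc0 : ∀ n, 0 ≤ c n)
    (hc : ∀ n (g : G), (g : G ⧸ Subgroup.center G) ∈ S n → c n ≤ ‖ρ.matrixCoeff φ v g‖) (N : ℕ) :
    ∑ n ∈ Finset.range N, c n ^ 2 * μ.real (S n) ≤ ∫ x, f x ^ 2 ∂μ := by
  -- `c_n ≤ f` on `S_n`
  have hcf : ∀ n, ∀ x ∈ S n, c n ^ 2 ≤ f x ^ 2 := by
    intro n x hx
    obtain ⟨g, rfl⟩ := QuotientGroup.mk_surjective x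
    exact pow_le_pow_left₀ (hc0 n) ((hc n g hx).trans (hdom g)) 2
  calc ∑ n ∈ Finset.range N, c n ^ 2 * μ.real (S n)
      = ∑ n ∈ Finset.range N, ∫ x in S n, c n ^ 2 ∂μ := by
        refine Finset.sum_congr rfl fun n _ => ?_
        rw [setIntegral_const, smul_eq_mul, mul_comm]
    _ ≤ ∑ n ∈ Finset.range N, ∫ x in S n, f x ^ 2 ∂μ := by
        refine Finset.sum_le_sum fun n _ => ?_
        exact setIntegral_mono_on (integrableOn_const (hSfin n).ne) hint.integrableOn (hSm n) (hcf n)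
    _ = ∫ x in ⋃ n ∈ Finset.range N, S n, f x ^ 2 ∂μ := by
        rw [integral_biUnion_finset _ (fun n _ => hSm n) (fun i _ j _ hij => hdisj hij)
          (fun n _ => hint.integrableOn)]
    _ ≤ ∫ x, f x ^ 2 ∂μ := setIntegral_le_integral hint (Eventually.of_forall fun x => sq_nonneg (f x))

/-- **Square-integrability modulo the centre ⇒ square-summability on disjoint shells.**  If `ρ` is square-integrable modulo the centre
w.r.t. `μ` (★ `Representation.IsSquareIntegrableModCenter`), `φ ∈ Ṽ`, `v ∈ V`, `S_n ⊆ G ⧸ Z(G)` are pairwise disjoint measurable sets of finite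
measure, and `0 ≤ c_n ≤ ‖c_{φ,v}(g)‖` whenever `gZ ∈ S_n`, then `Σ_n c_n² μ(S_n)` converges.  (For the zonal spherical function and the Cartan
shells `S_n = K tⁿ K Z/Z` this is `Σ_n |ω(tⁿ)|² μ(KtⁿK) < ∞`.) [cite: HarishChandra1970, Part I §1 p. 4] -/
theorem summable_sq_mul_measureReal (h : ρ.IsSquareIntegrableModCenter μ) {φ : Module.Dual ℂ V} (hφ : φ ∈ ρ.contragredient)
    (v : V) {S : ℕ → Set (G ⧸ Subgroup.center G)} (hSm : ∀ n, MeasurableSet (S n)) (hSfin : ∀ n, μ (S n) < ⊤)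
    (hdisj : Pairwise (Function.onFun Disjoint S)) {c : ℕ → ℝ} (hc0 : ∀ n, 0 ≤ c n)
    (hc : ∀ n (g : G), (g : G ⧸ Subgroup.center G) ∈ S n → c n ≤ ‖ρ.matrixCoeff φ v g‖) :
    Summable (fun n => c n ^ 2 * μ.real (S n)) := by
  obtain ⟨f, hf2, hdom⟩ := h φ hφ v
  refine summable_of_sum_range_le (c := ∫ x, f x ^ 2 ∂μ) (fun n => by positivity) fun N => ?_
  exact sum_sq_mul_measureReal_le_integral hdom hf2.integrable_sq hSm hSfin hdisj hc0 hc N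

end Summable

/-! ## §2 The zonal spherical coefficient of a `K`-spherical smooth representation -/

section Spherical

variable {G V : Type*} [Group G] [TopologicalSpace G] [IsTopologicalGroup G] [AddCommGroup V] [Module ℂ V]
  {ρ : Representation ℂ G V} {K : Subgroup G}

/-- **The spherical pair `(v₀, φ₀)`**: for a smooth `ρ` with a line of `K`-fixed vectors, `K` compact open, there are `v₀ ∈ V^K`,
`v₀ ≠ 0`, and a `K`-INVARIANT smooth linear form `φ₀ ∈ Ṽ` with `φ₀(v₀) = 1` (`φ₀ = ℓ ∘ e_K`, ★ `Representation.avgProjLinear`;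
«`Ṽ^K = (V^K)^*`»). [cite: Casselman1995, §2.1] [cite: CartierCorvallis1979, §IV.1 Cor. 4.1] -/
theorem exists_spherical_coefficient (hρ : ρ.IsSmooth) (hKc : IsCompact (K : Set G)) (hKo : IsOpen (K : Set G))
    (h1 : ρ.IsSpherical K) :
    ∃ v₀ ∈ ρ.fixedPoints K, v₀ ≠ 0 ∧ ∃ φ₀ ∈ ρ.contragredient,
      φ₀ v₀ = 1 ∧ ∀ κ ∈ K, ∀ w : V, φ₀ (ρ κ w) = φ₀ w := by
  -- a non-zero fixed vector
  haveI : Module.Finite ℂ (ρ.fixedPoints K) := Module.finite_of_finrank_eq_succ h1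
  obtain ⟨w₀, hw₀⟩ := finrank_eq_one_iff'.1 h1
  have hv₀ : (w₀ : V) ≠ 0 := fun h => hw₀.1 (Subtype.ext h)
  -- a linear form with `ℓ v₀ = 1`, averaged over `K`
  obtain ⟨ℓ, hℓ⟩ := Module.Projective.exists_dual_eq_one ℂ hv₀
  refine ⟨w₀, w₀.2, hv₀, ℓ.comp (ρ.avgProjLinear K hρ hKc),
    Representation.comp_avgProjLinear_mem_contragredient K hρ hKc hKo ℓ, ?_, fun κ hκ w => ?_⟩
  · rw [LinearMap.comp_apply, Representation.avgProjLinear_apply,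
      Representation.avgProj_of_forall_apply_eq hKc hKo ((ρ.mem_fixedPoints K _).1 w₀.2), hℓ]
  · rw [LinearMap.comp_apply, LinearMap.comp_apply, Representation.avgProjLinear_apply,
      Representation.avgProjLinear_apply, Representation.avgProj_apply_of_mem hKc (hρ w) hκ]

end Spherical

section Coefficient

variable {G V : Type*} [Group G] [AddCommGroup V] [Module ℂ V] {ρ : Representation ℂ G V} {K : Subgroup G}

/-- **Bi-`K`-invariance of the spherical coefficient**: for `v₀ ∈ V^K` and a `K`-invariant form `φ₀`,
`c_{φ₀,v₀}(κ₁ g κ₂) = c_{φ₀,v₀}(g)`. [cite: CartierCorvallis1979, §IV.1] -/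
theorem matrixCoeff_mul_mul_of_mem {v₀ : V} (hv₀ : v₀ ∈ ρ.fixedPoints K) {φ₀ : Module.Dual ℂ V}
    (hφ₀ : ∀ κ ∈ K, ∀ w : V, φ₀ (ρ κ w) = φ₀ w) {κ₁ κ₂ : G} (h₁ : κ₁ ∈ K) (h₂ : κ₂ ∈ K) (g : G) :
    ρ.matrixCoeff φ₀ v₀ (κ₁ * g * κ₂) = ρ.matrixCoeff φ₀ v₀ g := by
  rw [Representation.matrixCoeff_apply, Representation.matrixCoeff_apply, map_mul, map_mul,
    Module.End.mul_apply, Module.End.mul_apply, (ρ.mem_fixedPoints K v₀).1 hv₀ κ₂ h₂, hφ₀ κ₁ h₁]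

/-- The spherical coefficient is constant on each double coset `K g K`: if `x ∈ K g K` then `c_{φ₀,v₀}(x) = c_{φ₀,v₀}(g)`.
[cite: CartierCorvallis1979, §IV.1] -/
theorem matrixCoeff_eq_of_mem_doubleCoset {v₀ : V} (hv₀ : v₀ ∈ ρ.fixedPoints K) {φ₀ : Module.Dual ℂ V}
    (hφ₀ : ∀ κ ∈ K, ∀ w : V, φ₀ (ρ κ w) = φ₀ w) {g x : G} (hx : x ∈ DoubleCoset.doubleCoset g (K : Set G) K) :
    ρ.matrixCoeff φ₀ v₀ x = ρ.matrixCoeff φ₀ v₀ g := by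
  obtain ⟨κ₁, h₁, κ₂, h₂, rfl⟩ := DoubleCoset.mem_doubleCoset.1 hx
  exact matrixCoeff_mul_mul_of_mem hv₀ hφ₀ h₁ h₂ g

/-- The spherical coefficient takes the value `1` at the identity when `φ₀(v₀) = 1`. [cite: CartierCorvallis1979, §IV.1] -/
theorem matrixCoeff_one_eq_one {v₀ : V} {φ₀ : Module.Dual ℂ V} (h : φ₀ v₀ = 1) : ρ.matrixCoeff φ₀ v₀ 1 = 1 := by
  rw [Representation.matrixCoeff_one, h]

end Coefficient

end Literature.NumberTheory.Automorphic.SphericalCoefficient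

end
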